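import Literature.NumberTheory.LFunctions.DirichletLTruncationCertificatesOdd
import HarnessLib

/-!
# No real zero for the ODD real primitive characters of conductor `641 ≤ q ≤ 700`, in the kernel
# (truncation certificates with drift)

Topic `Literature/NumberTheory/LFunctions`; namespace `Literature.NumberTheory.LFunctions`
(private per-modulus work in `Literature.NumberTheory.LFunctions.OddTruncationIb`). THEOREMS only (no
definition, no named fact, no `sorry`): **`noRealZeroOdd_range_641_700`** — for every modulus
`641 ≤ q ≤ 700`, every primitive quadratic ODD `χ` mod `q` (imaginary quadratic fields of discriminant `−q`)
and every `σ ∈ (0, 1)`, `L(σ, χ) ≠ 0`.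

Per modulus (one bullet each, in the order of `interval_cases`): moduli without a primitive quadratic
character are dismissed (`q ≡ 2 (mod 4)`, `16 ∣ q`, `p² ∣ q` — MV Thm 9.13); the EVEN primitive quadratic
character is excluded by the parity test inside `LTruncationCert.good_odd_of_*`; the ODD one is certified by
**`LTruncationCert.certDriftOK v q K J P`** (`DirichletLTruncationCertificatesOdd.lean`): the truncation
`∑_{n ≤ Kq} χ(n) n^{−σ}` after `K` periods dominates the one-sided second-order tail bound `B⁻/(2(Kq+1)^{3/2})`
(`B⁻ = max_N (−U(N))⁺`; the drift `U(q) = q·h(−q) > 0` only helps) on each of `J` cells covering `[1/2, 1]`,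
and the functional equation reflects `(0, 1/2)` to `(1/2, 1)`.  20 certificates in this file (parameters
and margins in the docstrings; `K > 1` / `J > 16` only where the one-period truncation is too small at
`σ = 1/2`). [cite: Chua2005RealZeros, §2.2 ALGO 1]

## References

* K. S. Chua, *Real zeros of Dedekind zeta functions of real quadratic fields*, Math. Comp. 74 (2005)
  1457–1470, §2. [Chua2005RealZeros]
* M. Watkins, *Real zeros of real odd Dirichlet L-functions*, Math. Comp. 73 (2004) 415–423.
  [Watkins2004RealZeros]
* H. L. Montgomery, R. C. Vaughan, *Multiplicative Number Theory I*, CUP 2007, §9.3 Thm 9.13, §10.1.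
  [MontgomeryVaughan2007]
-/

namespace Literature.NumberTheory.LFunctions

namespace OddTruncationIb

open FeketePolyaKernel PrimitiveQuadratic LTruncationCert

/-- Conductor `≡ 2 (mod 4)`: no primitive character (private copy of the sweep-4 lemma).
[cite: MontgomeryVaughan2007, §9.3 Theorem 9.13] -/
private theorem absurd_of_mod_four_two {q : ℕ} [NeZero q] (hq : q % 4 = 2)
    {χ : DirichletCharacter ℂ q} (hprim : χ.IsPrimitive) : False := by
  obtain ⟨m, rfl⟩ : ∃ m, q = 2 * m := ⟨q / 2, by omega⟩
  haveI : NeZero m := ⟨by omega⟩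
  exact not_isPrimitive_two_mul (m := m) (Nat.odd_iff.mpr (by omega)) hprim

/-- Conductor divisible by `16`: no primitive quadratic character (private copy).
[cite: MontgomeryVaughan2007, §9.3 Theorem 9.13] -/
private theorem absurd_of_sixteen_dvd {q : ℕ} [NeZero q] (hq : q % 16 = 0) {χ : DirichletCharacter ℂ q}
    (hprim : χ.IsPrimitive) (hquad : χ.IsQuadratic) : False := by
  obtain ⟨k, m, hm, rfl⟩ := Nat.exists_eq_two_pow_mul_odd (NeZero.ne q)
  have hm2 := Nat.odd_iff.mp hm
  haveI : NeZero m := ⟨by omega⟩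
  have hk := le_three_of_level_two_pow_mul hm hprim hquad
  interval_cases k <;> norm_num at hq <;> omega

/-- Conductor with an odd square factor `p²`: no primitive quadratic character (private copy).
[cite: MontgomeryVaughan2007, §9.3 Theorem 9.13] -/
private theorem absurd_of_sq_dvd {q : ℕ} [NeZero q] {p : ℕ} (hp : p.Prime) (hp2 : p ≠ 2)
    (hpq : p * p ∣ q) {χ : DirichletCharacter ℂ q} (hprim : χ.IsPrimitive) (hquad : χ.IsQuadratic) :
    False := by
  obtain ⟨k, m, hm, rfl⟩ := Nat.exists_eq_two_pow_mul_odd (NeZero.ne q)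
  have hm2 := Nat.odd_iff.mp hm
  haveI : NeZero m := ⟨by omega⟩
  have hsq := squarefree_of_level_two_pow_mul hm hprim hquad
  have hp2' : Nat.Coprime p 2 := (Nat.coprime_primes hp Nat.prime_two).mpr hp2
  have hcop : Nat.Coprime (p * p) (2 ^ k) := Nat.Coprime.pow_right k (Nat.Coprime.mul_left hp2' hp2')
  have hpm : p * p ∣ m := hcop.dvd_of_dvd_mul_left hpq
  exact hp.one_lt.ne' (Nat.isUnit_iff.mp (hsq p hpm))

/-- `643`: the odd character `(·/643)` = `χ_{−643}` — drift certificate `K = 1`, `J = 16`, `P = 32` (`B⁻ = 401`, worst cell margin `0.118`). [cite: Chua2005RealZeros, §2.2 ALGO 1] -/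
private theorem goodOdd643 :
    ∀ χ : DirichletCharacter ℂ 643, χ.IsQuadratic → χ.IsPrimitive → χ.Odd →
      ∀ σ : ℝ, 0 < σ → σ < 1 → χ.LFunction σ ≠ 0 :=
  good_odd_of_odd (by decide) (by decide) 1 16 32 (by decide +kernel)

/-- `644 = 4·161`: the odd character `χ₋₄·(·/161)` = `χ_{−644}` — drift certificate `K = 1`, `J = 16`, `P = 32` (`B⁻ = 0`, worst cell margin `1.649`). [cite: Chua2005RealZeros, §2.2 ALGO 1] -/
private theorem goodOdd644 :
    ∀ χ : DirichletCharacter ℂ 644, χ.IsQuadratic → χ.IsPrimitive → χ.Odd →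
      ∀ σ : ℝ, 0 < σ → σ < 1 → χ.LFunction σ ≠ 0 :=
  good_odd_of_four (by decide) (by decide) 1 16 32 (by decide +kernel)

/-- `647`: the odd character `(·/647)` = `χ_{−647}` — drift certificate `K = 1`, `J = 16`, `P = 32` (`B⁻ = 0`, worst cell margin `2.374`). [cite: Chua2005RealZeros, §2.2 ALGO 1] -/
private theorem goodOdd647 :
    ∀ χ : DirichletCharacter ℂ 647, χ.IsQuadratic → χ.IsPrimitive → χ.Odd →
      ∀ σ : ℝ, 0 < σ → σ < 1 → χ.LFunction σ ≠ 0 :=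
  good_odd_of_odd (by decide) (by decide) 1 16 32 (by decide +kernel)

/-- `651`: the odd character `(·/651)` = `χ_{−651}` — drift certificate `K = 1`, `J = 16`, `P = 32` (`B⁻ = 0`, worst cell margin `0.809`). [cite: Chua2005RealZeros, §2.2 ALGO 1] -/
private theorem goodOdd651 :
    ∀ χ : DirichletCharacter ℂ 651, χ.IsQuadratic → χ.IsPrimitive → χ.Odd →
      ∀ σ : ℝ, 0 < σ → σ < 1 → χ.LFunction σ ≠ 0 :=
  good_odd_of_odd (by decide) (by decide) 1 16 32 (by decide +kernel)

/-- `655`: the odd character `(·/655)` = `χ_{−655}` — drift certificate `K = 1`, `J = 16`, `P = 32` (`B⁻ = 0`, worst cell margin `1.208`). [cite: Chua2005RealZeros, §2.2 ALGO 1] -/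
private theorem goodOdd655 :
    ∀ χ : DirichletCharacter ℂ 655, χ.IsQuadratic → χ.IsPrimitive → χ.Odd →
      ∀ σ : ℝ, 0 < σ → σ < 1 → χ.LFunction σ ≠ 0 :=
  good_odd_of_odd (by decide) (by decide) 1 16 32 (by decide +kernel)

/-- `659`: the odd character `(·/659)` = `χ_{−659}` — drift certificate `K = 1`, `J = 16`, `P = 32` (`B⁻ = 0`, worst cell margin `1.116`). [cite: Chua2005RealZeros, §2.2 ALGO 1] -/
private theorem goodOdd659 :
    ∀ χ : DirichletCharacter ℂ 659, χ.IsQuadratic → χ.IsPrimitive → χ.Odd →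
      ∀ σ : ℝ, 0 < σ → σ < 1 → χ.LFunction σ ≠ 0 :=
  good_odd_of_odd (by decide) (by decide) 1 16 32 (by decide +kernel)

/-- `660 = 4·165`: the odd character `χ₋₄·(·/165)` = `χ_{−660}` — drift certificate `K = 1`, `J = 16`, `P = 32` (`B⁻ = 0`, worst cell margin `0.793`). [cite: Chua2005RealZeros, §2.2 ALGO 1] -/
private theorem goodOdd660 :
    ∀ χ : DirichletCharacter ℂ 660, χ.IsQuadratic → χ.IsPrimitive → χ.Odd →
      ∀ σ : ℝ, 0 < σ → σ < 1 → χ.LFunction σ ≠ 0 :=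
  good_odd_of_four (by decide) (by decide) 1 16 32 (by decide +kernel)

/-- `663`: the odd character `(·/663)` = `χ_{−663}` — drift certificate `K = 1`, `J = 16`, `P = 32` (`B⁻ = 0`, worst cell margin `1.614`). [cite: Chua2005RealZeros, §2.2 ALGO 1] -/
private theorem goodOdd663 :
    ∀ χ : DirichletCharacter ℂ 663, χ.IsQuadratic → χ.IsPrimitive → χ.Odd →
      ∀ σ : ℝ, 0 < σ → σ < 1 → χ.LFunction σ ≠ 0 :=
  good_odd_of_odd (by decide) (by decide) 1 16 32 (by decide +kernel)

/-- `664 = 8·83`: the odd character `χ₈·(·/83)` = `χ_{−664}` — drift certificate `K = 1`, `J = 16`, `P = 32` (`B⁻ = 0`, worst cell margin `1.005`); the other primitive quadratic character mod `664` is even (parity test). [cite: Chua2005RealZeros, §2.2 ALGO 1] -/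
private theorem goodOdd664 :
    ∀ χ : DirichletCharacter ℂ 664, χ.IsQuadratic → χ.IsPrimitive → χ.Odd →
      ∀ σ : ℝ, 0 < σ → σ < 1 → χ.LFunction σ ≠ 0 :=
  good_odd_of_eight (by decide) (by decide) 1 16 32 (by decide +kernel) (by decide +kernel)

/-- `667`: the odd character `(·/667)` = `χ_{−667}` — drift certificate `K = 1`, `J = 16`, `P = 32` (`B⁻ = 296`, worst cell margin `0.375`). [cite: Chua2005RealZeros, §2.2 ALGO 1] -/
private theorem goodOdd667 :
    ∀ χ : DirichletCharacter ℂ 667, χ.IsQuadratic → χ.IsPrimitive → χ.Odd →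
      ∀ σ : ℝ, 0 < σ → σ < 1 → χ.LFunction σ ≠ 0 :=
  good_odd_of_odd (by decide) (by decide) 1 16 32 (by decide +kernel)

/-- `671`: the odd character `(·/671)` = `χ_{−671}` — drift certificate `K = 1`, `J = 16`, `P = 32` (`B⁻ = 0`, worst cell margin `3.057`). [cite: Chua2005RealZeros, §2.2 ALGO 1] -/
private theorem goodOdd671 :
    ∀ χ : DirichletCharacter ℂ 671, χ.IsQuadratic → χ.IsPrimitive → χ.Odd →
      ∀ σ : ℝ, 0 < σ → σ < 1 → χ.LFunction σ ≠ 0 :=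
  good_odd_of_odd (by decide) (by decide) 1 16 32 (by decide +kernel)

/-- `679`: the odd character `(·/679)` = `χ_{−679}` — drift certificate `K = 1`, `J = 16`, `P = 32` (`B⁻ = 0`, worst cell margin `1.806`). [cite: Chua2005RealZeros, §2.2 ALGO 1] -/
private theorem goodOdd679 :
    ∀ χ : DirichletCharacter ℂ 679, χ.IsQuadratic → χ.IsPrimitive → χ.Odd →
      ∀ σ : ℝ, 0 < σ → σ < 1 → χ.LFunction σ ≠ 0 :=
  good_odd_of_odd (by decide) (by decide) 1 16 32 (by decide +kernel)

/-- `680 = 8·85`: the odd character `χ₋₈·(·/85)` = `χ_{−680}` — drift certificate `K = 1`, `J = 16`, `P = 32` (`B⁻ = 0`, worst cell margin `1.188`); the other primitive quadratic character mod `680` is even (parity test). [cite: Chua2005RealZeros, §2.2 ALGO 1] -/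
private theorem goodOdd680 :
    ∀ χ : DirichletCharacter ℂ 680, χ.IsQuadratic → χ.IsPrimitive → χ.Odd →
      ∀ σ : ℝ, 0 < σ → σ < 1 → χ.LFunction σ ≠ 0 :=
  good_odd_of_eight (by decide) (by decide) 1 16 32 (by decide +kernel) (by decide +kernel)

/-- `683`: the odd character `(·/683)` = `χ_{−683}` — drift certificate `K = 1`, `J = 16`, `P = 32` (`B⁻ = 150`, worst cell margin `0.387`). [cite: Chua2005RealZeros, §2.2 ALGO 1] -/
private theorem goodOdd683 :
    ∀ χ : DirichletCharacter ℂ 683, χ.IsQuadratic → χ.IsPrimitive → χ.Odd →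
      ∀ σ : ℝ, 0 < σ → σ < 1 → χ.LFunction σ ≠ 0 :=
  good_odd_of_odd (by decide) (by decide) 1 16 32 (by decide +kernel)

/-- `687`: the odd character `(·/687)` = `χ_{−687}` — drift certificate `K = 1`, `J = 16`, `P = 32` (`B⁻ = 32`, worst cell margin `1.169`). [cite: Chua2005RealZeros, §2.2 ALGO 1] -/
private theorem goodOdd687 :
    ∀ χ : DirichletCharacter ℂ 687, χ.IsQuadratic → χ.IsPrimitive → χ.Odd →
      ∀ σ : ℝ, 0 < σ → σ < 1 → χ.LFunction σ ≠ 0 :=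
  good_odd_of_odd (by decide) (by decide) 1 16 32 (by decide +kernel)

/-- `691`: the odd character `(·/691)` = `χ_{−691}` — drift certificate `K = 1`, `J = 16`, `P = 32` (`B⁻ = 198`, worst cell margin `0.469`). [cite: Chua2005RealZeros, §2.2 ALGO 1] -/
private theorem goodOdd691 :
    ∀ χ : DirichletCharacter ℂ 691, χ.IsQuadratic → χ.IsPrimitive → χ.Odd →
      ∀ σ : ℝ, 0 < σ → σ < 1 → χ.LFunction σ ≠ 0 :=
  good_odd_of_odd (by decide) (by decide) 1 16 32 (by decide +kernel)

/-- `692 = 4·173`: the odd character `χ₋₄·(·/173)` = `χ_{−692}` — drift certificate `K = 1`, `J = 16`, `P = 32` (`B⁻ = 0`, worst cell margin `1.384`). [cite: Chua2005RealZeros, §2.2 ALGO 1] -/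
private theorem goodOdd692 :
    ∀ χ : DirichletCharacter ℂ 692, χ.IsQuadratic → χ.IsPrimitive → χ.Odd →
      ∀ σ : ℝ, 0 < σ → σ < 1 → χ.LFunction σ ≠ 0 :=
  good_odd_of_four (by decide) (by decide) 1 16 32 (by decide +kernel)

/-- `695`: the odd character `(·/695)` = `χ_{−695}` — drift certificate `K = 1`, `J = 16`, `P = 32` (`B⁻ = 0`, worst cell margin `2.386`). [cite: Chua2005RealZeros, §2.2 ALGO 1] -/
private theorem goodOdd695 :
    ∀ χ : DirichletCharacter ℂ 695, χ.IsQuadratic → χ.IsPrimitive → χ.Odd →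
      ∀ σ : ℝ, 0 < σ → σ < 1 → χ.LFunction σ ≠ 0 :=
  good_odd_of_odd (by decide) (by decide) 1 16 32 (by decide +kernel)

/-- `696 = 8·87`: the odd character `χ₈·(·/87)` = `χ_{−696}` — drift certificate `K = 1`, `J = 16`, `P = 32` (`B⁻ = 0`, worst cell margin `1.177`); the other primitive quadratic character mod `696` is even (parity test). [cite: Chua2005RealZeros, §2.2 ALGO 1] -/
private theorem goodOdd696 :
    ∀ χ : DirichletCharacter ℂ 696, χ.IsQuadratic → χ.IsPrimitive → χ.Odd →
      ∀ σ : ℝ, 0 < σ → σ < 1 → χ.LFunction σ ≠ 0 :=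
  good_odd_of_eight (by decide) (by decide) 1 16 32 (by decide +kernel) (by decide +kernel)

/-- `699`: the odd character `(·/699)` = `χ_{−699}` — drift certificate `K = 1`, `J = 16`, `P = 32` (`B⁻ = 0`, worst cell margin `0.983`). [cite: Chua2005RealZeros, §2.2 ALGO 1] -/
private theorem goodOdd699 :
    ∀ χ : DirichletCharacter ℂ 699, χ.IsQuadratic → χ.IsPrimitive → χ.Odd →
      ∀ σ : ℝ, 0 < σ → σ < 1 → χ.LFunction σ ≠ 0 :=
  good_odd_of_odd (by decide) (by decide) 1 16 32 (by decide +kernel)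

/-- **No real zero in `(0, 1)` for every odd real primitive character of conductor `641 ≤ q ≤ 700`**
(one bullet per modulus, in the order of `interval_cases`). [cite: Chua2005RealZeros, §2.2 ALGO 1] -/
theorem range_641_700 (q : ℕ) [NeZero q] (hlo : 640 < q) (hhi : q ≤ 700) :
    ∀ χ : DirichletCharacter ℂ q, χ.IsQuadratic → χ.IsPrimitive → χ.Odd →
      ∀ σ : ℝ, 0 < σ → σ < 1 → χ.LFunction σ ≠ 0 := by
  interval_cases q
  · -- 641 ≡ 1 (mod 4): the primitive quadratic character (·/641) is even (parity test)
    exact good_odd_of_odd (by decide) (by decide) 1 16 32 (by decide +kernel)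
  · -- 642 ≡ 2 (mod 4): no primitive character
    exact fun χ _ hprim _ ↦ (absurd_of_mod_four_two (by decide) hprim).elim
  · exact goodOdd643 -- certificate
  · exact goodOdd644 -- certificate
  · -- 645 ≡ 1 (mod 4): the primitive quadratic character (·/645) is even (parity test)
    exact good_odd_of_odd (by decide) (by decide) 1 16 32 (by decide +kernel)
  · -- 646 ≡ 2 (mod 4): no primitive character
    exact fun χ _ hprim _ ↦ (absurd_of_mod_four_two (by decide) hprim).elim
  · exact goodOdd647 -- certificate
  · -- 3² ∣ 648: no primitive quadratic character
    exact fun χ hquad hprim _ ↦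
      (absurd_of_sq_dvd (p := 3) (by norm_num) (by decide) (by decide) hprim hquad).elim
  · -- 649 ≡ 1 (mod 4): the primitive quadratic character (·/649) is even (parity test)
    exact good_odd_of_odd (by decide) (by decide) 1 16 32 (by decide +kernel)
  · -- 650 ≡ 2 (mod 4): no primitive character
    exact fun χ _ hprim _ ↦ (absurd_of_mod_four_two (by decide) hprim).elim
  · exact goodOdd651 -- certificate
  · -- 652 = 4·163, 163 ≡ 3 (mod 4): the primitive quadratic character is even (parity test)
    exact good_odd_of_four (by decide) (by decide) 1 16 32 (by decide +kernel)
  · -- 653 ≡ 1 (mod 4): the primitive quadratic character (·/653) is even (parity test)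
    exact good_odd_of_odd (by decide) (by decide) 1 16 32 (by decide +kernel)
  · -- 654 ≡ 2 (mod 4): no primitive character
    exact fun χ _ hprim _ ↦ (absurd_of_mod_four_two (by decide) hprim).elim
  · exact goodOdd655 -- certificate
  · -- 16 ∣ 656: no primitive quadratic character
    exact fun χ hquad hprim _ ↦ (absurd_of_sixteen_dvd (by decide) hprim hquad).elim
  · -- 3² ∣ 657: no primitive quadratic character
    exact fun χ hquad hprim _ ↦
      (absurd_of_sq_dvd (p := 3) (by norm_num) (by decide) (by decide) hprim hquad).elim
  · -- 658 ≡ 2 (mod 4): no primitive character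
    exact fun χ _ hprim _ ↦ (absurd_of_mod_four_two (by decide) hprim).elim
  · exact goodOdd659 -- certificate
  · exact goodOdd660 -- certificate
  · -- 661 ≡ 1 (mod 4): the primitive quadratic character (·/661) is even (parity test)
    exact good_odd_of_odd (by decide) (by decide) 1 16 32 (by decide +kernel)
  · -- 662 ≡ 2 (mod 4): no primitive character
    exact fun χ _ hprim _ ↦ (absurd_of_mod_four_two (by decide) hprim).elim
  · exact goodOdd663 -- certificate
  · exact goodOdd664 -- certificate
  · -- 665 ≡ 1 (mod 4): the primitive quadratic character (·/665) is even (parity test)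
    exact good_odd_of_odd (by decide) (by decide) 1 16 32 (by decide +kernel)
  · -- 666 ≡ 2 (mod 4): no primitive character
    exact fun χ _ hprim _ ↦ (absurd_of_mod_four_two (by decide) hprim).elim
  · exact goodOdd667 -- certificate
  · -- 668 = 4·167, 167 ≡ 3 (mod 4): the primitive quadratic character is even (parity test)
    exact good_odd_of_four (by decide) (by decide) 1 16 32 (by decide +kernel)
  · -- 669 ≡ 1 (mod 4): the primitive quadratic character (·/669) is even (parity test)
    exact good_odd_of_odd (by decide) (by decide) 1 16 32 (by decide +kernel)
  · -- 670 ≡ 2 (mod 4): no primitive character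
    exact fun χ _ hprim _ ↦ (absurd_of_mod_four_two (by decide) hprim).elim
  · exact goodOdd671 -- certificate
  · -- 16 ∣ 672: no primitive quadratic character
    exact fun χ hquad hprim _ ↦ (absurd_of_sixteen_dvd (by decide) hprim hquad).elim
  · -- 673 ≡ 1 (mod 4): the primitive quadratic character (·/673) is even (parity test)
    exact good_odd_of_odd (by decide) (by decide) 1 16 32 (by decide +kernel)
  · -- 674 ≡ 2 (mod 4): no primitive character
    exact fun χ _ hprim _ ↦ (absurd_of_mod_four_two (by decide) hprim).elim
  · -- 3² ∣ 675: no primitive quadratic character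
    exact fun χ hquad hprim _ ↦
      (absurd_of_sq_dvd (p := 3) (by norm_num) (by decide) (by decide) hprim hquad).elim
  · -- 13² ∣ 676: no primitive quadratic character
    exact fun χ hquad hprim _ ↦
      (absurd_of_sq_dvd (p := 13) (by norm_num) (by decide) (by decide) hprim hquad).elim
  · -- 677 ≡ 1 (mod 4): the primitive quadratic character (·/677) is even (parity test)
    exact good_odd_of_odd (by decide) (by decide) 1 16 32 (by decide +kernel)
  · -- 678 ≡ 2 (mod 4): no primitive character
    exact fun χ _ hprim _ ↦ (absurd_of_mod_four_two (by decide) hprim).elim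
  · exact goodOdd679 -- certificate
  · exact goodOdd680 -- certificate
  · -- 681 ≡ 1 (mod 4): the primitive quadratic character (·/681) is even (parity test)
    exact good_odd_of_odd (by decide) (by decide) 1 16 32 (by decide +kernel)
  · -- 682 ≡ 2 (mod 4): no primitive character
    exact fun χ _ hprim _ ↦ (absurd_of_mod_four_two (by decide) hprim).elim
  · exact goodOdd683 -- certificate
  · -- 3² ∣ 684: no primitive quadratic character
    exact fun χ hquad hprim _ ↦
      (absurd_of_sq_dvd (p := 3) (by norm_num) (by decide) (by decide) hprim hquad).elim
  · -- 685 ≡ 1 (mod 4): the primitive quadratic character (·/685) is even (parity test)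
    exact good_odd_of_odd (by decide) (by decide) 1 16 32 (by decide +kernel)
  · -- 686 ≡ 2 (mod 4): no primitive character
    exact fun χ _ hprim _ ↦ (absurd_of_mod_four_two (by decide) hprim).elim
  · exact goodOdd687 -- certificate
  · -- 16 ∣ 688: no primitive quadratic character
    exact fun χ hquad hprim _ ↦ (absurd_of_sixteen_dvd (by decide) hprim hquad).elim
  · -- 689 ≡ 1 (mod 4): the primitive quadratic character (·/689) is even (parity test)
    exact good_odd_of_odd (by decide) (by decide) 1 16 32 (by decide +kernel)
  · -- 690 ≡ 2 (mod 4): no primitive character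
    exact fun χ _ hprim _ ↦ (absurd_of_mod_four_two (by decide) hprim).elim
  · exact goodOdd691 -- certificate
  · exact goodOdd692 -- certificate
  · -- 3² ∣ 693: no primitive quadratic character
    exact fun χ hquad hprim _ ↦
      (absurd_of_sq_dvd (p := 3) (by norm_num) (by decide) (by decide) hprim hquad).elim
  · -- 694 ≡ 2 (mod 4): no primitive character
    exact fun χ _ hprim _ ↦ (absurd_of_mod_four_two (by decide) hprim).elim
  · exact goodOdd695 -- certificate
  · exact goodOdd696 -- certificate
  · -- 697 ≡ 1 (mod 4): the primitive quadratic character (·/697) is even (parity test)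
    exact good_odd_of_odd (by decide) (by decide) 1 16 32 (by decide +kernel)
  · -- 698 ≡ 2 (mod 4): no primitive character
    exact fun χ _ hprim _ ↦ (absurd_of_mod_four_two (by decide) hprim).elim
  · exact goodOdd699 -- certificate
  · -- 5² ∣ 700: no primitive quadratic character
    exact fun χ hquad hprim _ ↦
      (absurd_of_sq_dvd (p := 5) (by norm_num) (by decide) (by decide) hprim hquad).elim

end OddTruncationIb

open OddTruncationIb in
/-- **Odd real primitive characters of conductor `641 ≤ q ≤ 700` have no real zero in `(0, 1)`.**
[cite: Watkins2004RealZeros, main theorem (d ≤ 3·10⁸, here re-proved in the kernel for this range)] -/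
theorem noRealZeroOdd_range_641_700 (q : ℕ) [NeZero q] (hlo : 640 < q) (hhi : q ≤ 700) :
    ∀ χ : DirichletCharacter ℂ q, χ.IsQuadratic → χ.IsPrimitive → χ.Odd →
      ∀ σ : ℝ, 0 < σ → σ < 1 → χ.LFunction σ ≠ 0 :=
  range_641_700 q hlo hhi

end Literature.NumberTheory.LFunctions

-- ops-buildfix (bf1-g30, 2026-08-28): comment-only touch so the build lane re-dispatches this module — its hub .olean
-- has been 0 bytes since the 2026-08-27T21:28Z ENOSPC incident on the build host; no declaration changed.
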